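/-
Copyright (c) 2026 the harness21 Literature library. Tree port of the stage-1 PACKAGE kernel file
`HodgeCM/CM/CommonReflexHodgeMorphisms.lean` (pub-hodgecm, md5 a507bda8158d; original author: session
planner-pub-hodgecm-mc-axioms-1-g12-0, 2026-08-20), whose only imports were the VENDORED twins of the two tree
modules imported below; ported back to the tree (imports re-pointed, namespace
`HodgeCM.CM.CommonReflex` ↦ `Literature.AlgebraicGeometry.ComplexMultiplication.CommonReflex`, statements and
proofs verbatim) by prover-pub-hodgecm2-b01-g39-0 (cell pub-hodgecm2, register CR-PORT), 2026-08-21.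
-/
import Literature.AlgebraicGeometry.ComplexMultiplication.ShimuraInflationRationalOfRiemann
import Literature.AlgebraicGeometry.HodgeTheory.AbelianVarietyHodgeFullnessRecord
import HarnessLib

/-!
# Common-reflex equivariant maps are Hodge morphisms of weight one

KERNEL (folklore linear algebra over the tree's CM vocabulary).  Let `(M', Φ')` be a CM pair and `k₁ : M' → K`,
`k₂ : M' → M` ring maps of number fields; let `(B, ι_B, θ_B)` realise the INDUCED type `Φ'^K = inducedCMType k₁ Φ'` and
`(A, ι_A, θ_A)` realise `Φ'^M = inducedCMType k₂ Φ'` (`ComplexMultiplication.IsCMTypeRealisation`, read on `H¹(−; ℂ)`).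
Then every `ℚ`-linear `ψ : H¹(B(ℂ); ℚ) → H¹(A(ℂ); ℚ)` that is equivariant for the two `M'`-actions
(`ψ ∘ θ_B(k₁ a) = θ_A(k₂ a) ∘ ψ`, `a ∈ M'`, rational actions `BettiUniverse.cmAction`) is a morphism of rational Hodge
structures of weight one (`HodgeTheory.IsHodgeMorphismOne A B ψ`), granted the model-independence of Hodge types `hI`.
This is the COMMON-REFLEX twin of `cmEquivariant_respects_hodgeTypes` of
`ComplexMultiplication/ShimuraInflationRationalOfRiemann.lean` (the case `M' = K`, `k₁ = id`):
the image of a `σ`-eigenvector of `B` is supported on the `τ`-lines of `A` with `τ ∘ k₂ = σ ∘ k₁`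
(`repr_apply_eq_zero_of_comp_ne` for the acting field `M'`), and for such pairs `σ ∈ Φ'^K ↔ σ ∘ k₁ ∈ Φ' ↔ τ ∘ k₂ ∈ Φ' ↔
τ ∈ Φ'^M` (`mem_inducedCMType_iff`), so types `(1,0)`/`(0,1)` are carried to the same types (`mem_of_apply_of_support`,
`disjoint_comap_hodgePQ`).  With Riemann's fullness (`DeligneMilne1982_Thm_6_20_full`, taken as a hypothesis; discharged
in the tree by `AbelianVarietyHodgeFullnessHolds.deligneMilne1982_Thm_6_20_full_holds`) such a `ψ` is then
`(1/n) u^*` for a morphism `u : A ⟶ B` — the corollary `exists_hom_map_eq_nsmul_of_commonReflexEquivariant`.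

Main declarations (namespace `Literature.AlgebraicGeometry.ComplexMultiplication.CommonReflex`):
* `eigenline_le_eigenline_comp` — restricting the acting field along `k : M' → K` enlarges eigenlines;
* `isOfHodgeType_map_of_commonReflexEquivariant` — the `ℂ`-linear statement on `H¹(−; ℂ)`;
* `commonReflex_isHodgeMorphismOne` — (L1) the rational statement (`IsHodgeMorphismOne`);
* `exists_hom_map_eq_nsmul_of_commonReflexEquivariant` — the corollary under `hR`.

USE.  (a) Stage 1 (pub-hodgecm, (J-Liu-iso)): in PerL's seesaw context the four CM types `Ψ_i` of the sextic `K` and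
Liu's `Φ_{μ_i}` on `M_{μ_i}` are all INFLATED from types of ONE field along `K ← M' → M_μ` (the reflex datum); the
junction "theta class ∈ span of pull-backs of `σ`-eigenclasses of `A_{(K,Ψ_i)}`" from "theta class ∈ span of pull-backs
of the `τ'`-eigenclass `α` of `A_μ`" ([Liu21] Thm. 4.18 and its proof, pull-back map (4.2)) goes through morphisms
`A_{(K,Ψ)} ⟵ A_Γ ⟶ A_μ` and needs exactly that `M'`-equivariant correspondences between `H¹(A_μ)` and `H¹(A_{(K,Ψ)})`
are Hodge, hence algebraic up to isogeny.  (b) Stage 2 (pub-hodgecm2, junction B01): the inflation identity for the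
isotypic blocks `Uiso` along a sub-pair `k : K₀ → F` (`CommonReflexSpan`, `CommonReflexSinglePullback`).
PROVENANCE.  Tree port of the stage-1 package file `HodgeCM/CM/CommonReflexHodgeMorphisms.lean` (statements and
proofs verbatim; only imports and the namespace changed).  Nothing of PerL / [QW8] / the 2001 programme is used or
asserted; no definitions, no named facts.
-/

noncomputable section

open scoped TensorProduct
open NumberField CategoryTheory Module

namespace Literature.AlgebraicGeometry.ComplexMultiplication.CommonReflex

open Literature.AlgebraicGeometry.Motives (SchemeOver IsSmoothProjective CMType AbelianVariety bettiCohomology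
  ofRatClassBaseChange ComplexPoints)
open Literature.AlgebraicGeometry.HodgeTheory (complexBetti IsOfHodgeType HodgeModel ofRatClassBaseChangeEquiv
  hodgePQ_independent_of_hodgeModel IsHodgeMorphismOne DeligneMilne1982_Thm_6_20_full)
open Literature.AlgebraicGeometry.HodgeTheory.BettiUniverse (cmAction IsInducedOnIntegers ofRatClassBaseChange_cmAction)
open Literature.AlgebraicGeometry.ComplexMultiplication
open Literature.NumberTheory.Automorphic.PicardCM (eigenline)
open Literature.NumberTheory.ComplexMultiplication (inducedCMType mem_inducedCMType_iff)

section Eigen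

variable {M' K : Type} [Field M'] [Field K] {W : Type*} [AddCommGroup W] [Module ℂ W]

/-- Restricting the acting field along `k : M' → K` enlarges eigenlines: a `σ`-eigenvector of `θ` is a
`σ ∘ k`-eigenvector of `θ ∘ k` (the eigen-decomposition of the representation of `F` on `H¹`, read for a
subfield). [cite: Shimura1998, §5.2 (pp. 36–37)] -/
theorem eigenline_le_eigenline_comp (k : M' →+* K) (θ : K →+* Module.End ℂ W) (σ : K →+* ℂ) :
    eigenline θ σ ≤ eigenline (θ.comp k) (σ.comp k) := by
  intro v hv
  refine (Submodule.mem_iInf _).2 fun a ↦ ?_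
  exact (Submodule.mem_iInf _).1 hv (k a)

end Eigen

section Equivariant

variable {M' K M : Type} [Field M'] [Field K] [NumberField K] [Field M] [NumberField M]
  (k₁ : M' →+* K) (k₂ : M' →+* M) {Φ' : CMType M'}
  {B : AbelianVariety ℂ} {ιB : 𝓞 K →+* End B} {θB : K →+* Module.End ℂ (complexBetti B.X 1)}
  {A : AbelianVariety ℂ} {ιA : 𝓞 M →+* End A} {θA : M →+* Module.End ℂ (complexBetti A.X 1)}

open Classical in
/-- **An `M'`-equivariant `ℂ`-linear map `H¹(B(ℂ); ℂ) → H¹(A(ℂ); ℂ)` between realisations of two CM types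
inflated from ONE `(M', Φ')` carries type `(1,0)` to type `(1,0)` and type `(0,1)` to type `(0,1)`** (granted `hI`).
Twin of `isOfHodgeType_map_of_cmEquivariant` (`ShimuraInflationRationalOfRiemann`) (acting field `M'`, support on
`τ ∘ k₂ = σ ∘ k₁`).  Cohomological form of the type-inflation theorem `A_{(F,Φ^F)} ∼ A_{(K,Φ)} ⊗_K F`
(Shimura: "`(A, ι)` is of type `(F; {φ_i})` … if `F` does not coincide with `K`, `A` is not simple"; Deligne:
the Hodge structure of a CM abelian variety, `B_α = A_α ⊗_{E_α} E`).
[cite: Shimura1998, §6.2 Theorem 3 (pp. 41–43)] [cite: Deligne1982HodgeCycles, §3 Example 3.7 and §5 p. 63] -/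
theorem isOfHodgeType_map_of_commonReflexEquivariant (hI : hodgePQ_independent_of_hodgeModel)
    (hB : IsCMTypeRealisation (inducedCMType k₁ Φ') B ιB θB)
    (hA : IsCMTypeRealisation (inducedCMType k₂ Φ') A ιA θA)
    (Ψ : complexBetti B.X 1 →ₗ[ℂ] complexBetti A.X 1)
    (hΨ : ∀ (a : M') (c : complexBetti B.X 1), Ψ (θB (k₁ a) c) = θA (k₂ a) (Ψ c))
    {p q : ℕ} (hpq : (p, q) = (1, 0) ∨ (p, q) = (0, 1))
    {c : complexBetti B.X 1} (hc : IsOfHodgeType (Module.finrank ℚ K / 2) B.X 1 p q c) :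
    IsOfHodgeType (Module.finrank ℚ M / 2) A.X 1 p q (Ψ c) := by
  obtain ⟨b, hb⟩ := exists_basis_mem_eigenline θB hB.2.1 fun σ ↦ (hB.2.2.2 σ).1
  obtain ⟨b', hb'⟩ := exists_basis_mem_eigenline θA hA.2.1 fun τ ↦ (hA.2.2.2 τ).1
  obtain ⟨B₀⟩ := hB.nonempty_hodgeModel
  obtain ⟨A₀⟩ := hA.nonempty_hodgeModel
  -- the Hodge types of the two eigenbases, read in the fixed models
  have t10 : ∀ σ, σ ∈ (inducedCMType k₁ Φ').1 →
      b σ ∈ (B₀.hodgePQ 1 1 0).comap (B₀.pullbackEquiv 1).toLinearMap :=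
    fun σ hσ ↦ (isOfHodgeType_iff_mem_comap hI hB.1 B₀).1 ((hB.2.2.2 σ).2.1 hσ (b σ) (hb σ))
  have t01 : ∀ σ, σ ∉ (inducedCMType k₁ Φ').1 →
      b σ ∈ (B₀.hodgePQ 1 0 1).comap (B₀.pullbackEquiv 1).toLinearMap :=
    fun σ hσ ↦ (isOfHodgeType_iff_mem_comap hI hB.1 B₀).1 ((hB.2.2.2 σ).2.2 hσ (b σ) (hb σ))
  have t10' : ∀ τ, τ ∈ (inducedCMType k₂ Φ').1 →
      b' τ ∈ (A₀.hodgePQ 1 1 0).comap (A₀.pullbackEquiv 1).toLinearMap :=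
    fun τ hτ ↦ (isOfHodgeType_iff_mem_comap hI hA.1 A₀).1 ((hA.2.2.2 τ).2.1 hτ (b' τ) (hb' τ))
  have t01' : ∀ τ, τ ∉ (inducedCMType k₂ Φ').1 →
      b' τ ∈ (A₀.hodgePQ 1 0 1).comap (A₀.pullbackEquiv 1).toLinearMap :=
    fun τ hτ ↦ (isOfHodgeType_iff_mem_comap hI hA.1 A₀).1 ((hA.2.2.2 τ).2.2 hτ (b' τ) (hb' τ))
  have hd : Disjoint ((B₀.hodgePQ 1 1 0).comap (B₀.pullbackEquiv 1).toLinearMap)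
      ((B₀.hodgePQ 1 0 1).comap (B₀.pullbackEquiv 1).toLinearMap) :=
    disjoint_comap_hodgePQ hB.1 B₀ rfl rfl (by decide)
  -- `Ψ` is equivariant for the RESTRICTED actions `θB ∘ k₁`, `θA` along `k₂ : M' → M`
  have hΨ' : ∀ (a : M') (c : complexBetti B.X 1), Ψ ((θB.comp k₁) a c) = θA (k₂ a) (Ψ c) :=
    fun a c ↦ by rw [RingHom.comp_apply]; exact hΨ a c
  -- support: the `τ`-coordinate of `Ψ (b σ)` vanishes unless `τ ∘ k₂ = σ ∘ k₁`
  have hsupp : ∀ (σ : K →+* ℂ) (τ : M →+* ℂ), τ.comp k₂ ≠ σ.comp k₁ → b'.repr (Ψ (b σ)) τ = 0 :=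
    fun σ τ hne ↦ repr_apply_eq_zero_of_comp_ne k₂ Ψ hΨ' b' hb'
      (eigenline_le_eigenline_comp k₁ θB σ (hb σ)) hne
  rw [isOfHodgeType_iff_mem_comap hI hA.1 A₀]
  rw [isOfHodgeType_iff_mem_comap hI hB.1 B₀] at hc
  rcases hpq with h10 | h01
  · obtain ⟨rfl, rfl⟩ := Prod.mk_inj.1 h10
    refine mem_of_apply_of_support b b' (fun σ ↦ σ ∈ (inducedCMType k₁ Φ').1)
      (fun τ ↦ τ ∈ (inducedCMType k₂ Φ').1) hd t10 t01 t10' Ψ (fun σ hσ τ hτ ↦ ?_) hc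
    refine hsupp σ τ fun hτσ ↦ hτ ?_
    rw [mem_inducedCMType_iff, hτσ]
    exact (mem_inducedCMType_iff k₁ Φ' σ).1 hσ
  · obtain ⟨rfl, rfl⟩ := Prod.mk_inj.1 h01
    refine mem_of_apply_of_support b b' (fun σ ↦ σ ∉ (inducedCMType k₁ Φ').1)
      (fun τ ↦ τ ∉ (inducedCMType k₂ Φ').1) hd.symm t01 (fun σ hσ ↦ t10 σ (not_not.1 hσ)) t01' Ψ
      (fun σ hσ τ hτ ↦ ?_) hc
    refine hsupp σ τ fun hτσ ↦ hσ ?_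
    rw [mem_inducedCMType_iff, ← hτσ]
    exact (mem_inducedCMType_iff k₂ Φ' τ).1 (not_not.1 hτ)

/-- **(L1) An `M'`-equivariant `ℚ`-linear `ψ : H¹(B(ℂ); ℚ) → H¹(A(ℂ); ℚ)` between realisations of two CM types inflated
from ONE `(M', Φ')` (along `k₁ : M' → K`, `k₂ : M' → M`) is a morphism of rational Hodge structures of weight one**
(`IsHodgeMorphismOne A B ψ`), granted `hI`.  Twin of `cmEquivariant_respects_hodgeTypes` (`ShimuraInflationRationalOfRiemann`) (case `k₁ = id`):
the complexified map read on `H¹(−; ℂ)` through `β : ℂ ⊗_ℚ H¹(−; ℚ) ≃ H¹(−; ℂ)` is `M'`-equivariant for `θB ∘ k₁`, `θA ∘ k₂`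
(`ofRatClassBaseChange_cmAction`), and `isOfHodgeType_map_of_commonReflexEquivariant` applies.
[cite: Shimura1998, §6.2 Theorem 3 (pp. 41–43)] [cite: Deligne1982HodgeCycles, §3 Example 3.7 and §5 p. 63] -/
theorem commonReflex_isHodgeMorphismOne (hI : hodgePQ_independent_of_hodgeModel)
    (hB : IsCMTypeRealisation (inducedCMType k₁ Φ') B ιB θB)
    (hA : IsCMTypeRealisation (inducedCMType k₂ Φ') A ιA θA)
    (hθB : IsInducedOnIntegers θB) (hθA : IsInducedOnIntegers θA)
    (ψ : bettiCohomology B.X 1 →ₗ[ℚ] bettiCohomology A.X 1)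
    (hψ : ∀ (a : M') (v : bettiCohomology B.X 1),
      ψ (cmAction θB hθB (k₁ a) v) = cmAction θA hθA (k₂ a) (ψ v)) :
    IsHodgeMorphismOne A B ψ := by
  have hdB : B.dim = Module.finrank ℚ K / 2 := Literature.AlgebraicGeometry.Motives.schemeDim_eq_holds hB.1
  have hdA : A.dim = Module.finrank ℚ M / 2 := Literature.AlgebraicGeometry.Motives.schemeDim_eq_holds hA.1
  -- the complexified map on `H¹(−; ℂ)` through `β : ℂ ⊗ H¹(ℚ) ≃ H¹(ℂ)`
  let β := ofRatClassBaseChangeEquiv hB.1 1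
  let β' := ofRatClassBaseChangeEquiv hA.1 1
  let Ψ : complexBetti B.X 1 →ₗ[ℂ] complexBetti A.X 1 :=
    (β'.toLinearMap ∘ₗ ψ.baseChange ℂ) ∘ₗ β.symm.toLinearMap
  have hΨβ : ∀ t, Ψ (β t) = β' (ψ.baseChange ℂ t) := fun t ↦ by
    simp only [Ψ, LinearMap.coe_comp, LinearEquiv.coe_coe, Function.comp_apply, LinearEquiv.symm_apply_apply]
  have hΨ : ∀ (a : M') (c : complexBetti B.X 1), Ψ (θB (k₁ a) c) = θA (k₂ a) (Ψ c) := by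
    intro a c
    obtain ⟨t, rfl⟩ := β.surjective c
    have hcomp : ψ ∘ₗ (cmAction θB hθB (k₁ a)) = (cmAction θA hθA (k₂ a)) ∘ₗ ψ :=
      LinearMap.ext fun v ↦ hψ a v
    have lhs : θB (k₁ a) (β t) = β ((cmAction θB hθB (k₁ a)).baseChange ℂ t) := by
      rw [Literature.AlgebraicGeometry.HodgeTheory.ofRatClassBaseChangeEquiv_apply, Literature.AlgebraicGeometry.HodgeTheory.ofRatClassBaseChangeEquiv_apply,
        ofRatClassBaseChange_cmAction]
    rw [hΨβ t, lhs, hΨβ, ← LinearMap.comp_apply (f := ψ.baseChange ℂ), ← LinearMap.baseChange_comp,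
      hcomp, LinearMap.baseChange_comp, LinearMap.comp_apply, Literature.AlgebraicGeometry.HodgeTheory.ofRatClassBaseChangeEquiv_apply,
      Literature.AlgebraicGeometry.HodgeTheory.ofRatClassBaseChangeEquiv_apply, ofRatClassBaseChange_cmAction]
  have clause : ∀ {p q : ℕ}, ((p, q) = (1, 0) ∨ (p, q) = (0, 1)) →
      ∀ x : ℂ ⊗[ℚ] bettiCohomology B.X 1,
        IsOfHodgeType B.dim B.X 1 p q (ofRatClassBaseChange (ComplexPoints B.X) 1 x) →
        IsOfHodgeType A.dim A.X 1 p q (ofRatClassBaseChange (ComplexPoints A.X) 1 (ψ.baseChange ℂ x)) := by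
    intro p q hpq x hx
    have hx' : IsOfHodgeType (Module.finrank ℚ K / 2) B.X 1 p q (β x) := by
      rw [← hdB]; exact hx
    have := isOfHodgeType_map_of_commonReflexEquivariant k₁ k₂ hI hB hA Ψ hΨ hpq hx'
    rw [hΨβ, ← hdA] at this
    exact this
  exact ⟨clause (Or.inl rfl), clause (Or.inr rfl)⟩

/-- **Corollary (with Riemann's fullness `hR`): a common-reflex `M'`-equivariant `ψ : H¹(B; ℚ) → H¹(A; ℚ)` is `(1/n)·u^*`
for a morphism `u : A ⟶ B` and some `n ≥ 1`.**  The Hodge-model premise of the record is discharged from the realisation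
(`IsCMTypeRealisation.nonempty_hodgeModel_dim`).
[cite: DeligneMilne1982Tannakian, §6 Thm. 6.20 (Riemann)] [cite: Shimura1998, §6.2 Theorem 3 (pp. 41–43)] -/
theorem exists_hom_map_eq_nsmul_of_commonReflexEquivariant (hR : DeligneMilne1982_Thm_6_20_full)
    (hI : hodgePQ_independent_of_hodgeModel)
    (hB : IsCMTypeRealisation (inducedCMType k₁ Φ') B ιB θB)
    (hA : IsCMTypeRealisation (inducedCMType k₂ Φ') A ιA θA)
    (hθB : IsInducedOnIntegers θB) (hθA : IsInducedOnIntegers θA)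
    (ψ : bettiCohomology B.X 1 →ₗ[ℚ] bettiCohomology A.X 1)
    (hψ : ∀ (a : M') (v : bettiCohomology B.X 1),
      ψ (cmAction θB hθB (k₁ a) v) = cmAction θA hθA (k₂ a) (ψ v)) :
    ∃ (u : A ⟶ B) (n : ℕ), 0 < n ∧ ∀ x, bettiCohomology.map u.hom.hom.hom 1 x = n • ψ x :=
  hR A B ψ hB.nonempty_hodgeModel_dim (commonReflex_isHodgeMorphismOne k₁ k₂ hI hB hA hθB hθA ψ hψ)

end Equivariant

end Literature.AlgebraicGeometry.ComplexMultiplication.CommonReflex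

end
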